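import Summits.Ventures.PercRepro.SixThreeDemand
import Summits.Ventures.PercRepro.SixThreeSmall

/-!
# PercRepro — the small planes reduce to three planar inequalities (p2, gen 6)

mine-2 `MINE2-RLS.md` §19.6: on a plane `G` of a core matroid with `|E ∖ G| ≤ 5` the per-plane inequality follows
from a statement about the rank-`3` matroid `G` alone.  With `t = 6 − ρ(E ∖ G) ∈ {1, 2, 3}`, `n = 6 − t`,
`v(B, n) = n·w₁ + (2n − 3)·w₂ + C(n − 2, 2)·w₂⁻` (the shares of `SixThreeSmall.lean`) and the demands of
`SixThreeDemand.lean`, the planar inequalities are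

    (I₁)  Σ_{B ∈ R₃(G)} v(B, 5) ≥ 3 (N₃ − 1)            (ρ(E ∖ G) = 5)
    (I₂)  Σ_{B ∈ R₃(G)} v(B, 4) ≥ 3 (N₃ − 1 − g′)       (ρ(E ∖ G) = 4)
    (I₃)  Σ_{B ∈ R₃(G)} v(B, 3) ≥ 3 #{B ∈ R₃(G) : ρ(G ∖ B) = 3}   (ρ(E ∖ G) = 3).

`perPlane_small_of_planar` derives `3·#U_G ≤ supply(G)` from them for every plane with `ρ(E ∖ G) ≤ 5` (using all
`|E ∖ G| ≥ 6 − t` outside points: `vSupply` is monotone in `n`), and `SixThreeCompose.lean` composes this with the frame: C-025 at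
`(6, 3)` on every finite matroid follows from Theorem P₁ and `(I₁)`–`(I₃)` on the planes of the core matroids.
-/

namespace PercRepro

namespace SixThree

open Finset ThmH PerFlat

variable {α : Type*} [DecidableEq α] {M : Matroid α} [M.Finite]

/-- `v(B, n)` is monotone in `n`. -/
theorem vSupply_mono (M : Matroid α) [M.Finite] (B : Finset α) {n n' : ℕ} (hn : 3 ≤ n) (hnn' : n ≤ n') :
    vSupply M B n ≤ vSupply M B n' := by
  unfold vSupply
  have hΛ := Lam_nonneg M B
  have h1 : (0 : ℚ) ≤ (6 : ℚ) ^ (B.card - 3) := by positivity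
  have h2 : (0 : ℚ) ≤ (B.card : ℚ) := by positivity
  have hw₁ : 0 ≤ w₁ M B := by unfold w₁; exact div_nonneg h1 (by linarith)
  have hw₂ : 0 ≤ w₂ M B := by unfold w₂; exact div_nonneg h1 (by linarith)
  have hw₂m : 0 ≤ w₂m M B := w₂m_nonneg M B
  have hc : ((n - 2).choose 2 : ℕ) ≤ (n' - 2).choose 2 := Nat.choose_le_choose 2 (by omega)
  have hc' : (((n - 2).choose 2 : ℕ) : ℚ) ≤ (((n' - 2).choose 2 : ℕ) : ℚ) := by exact_mod_cast hc
  have hn' : (n : ℚ) ≤ n' := by exact_mod_cast hnn'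
  nlinarith [mul_le_mul_of_nonneg_right hn' hw₁, mul_le_mul_of_nonneg_right hn' hw₂,
    mul_le_mul_of_nonneg_right hc' hw₂m]

/-- **Demand at type `3`**: when `ρ(E ∖ G) ≤ 3`, every bottom set `B` has `ρ(G ∖ B) = 3`
(`6 = ρ(E ∖ B) ≤ ρ(E ∖ G) + ρ(G ∖ B)`). -/
theorem UqG_subset_demand3 {G : Finset α} (hG : G ∈ planes M)
    (hr : M.eRk ((gr M \ G : Finset α) : Set α) ≤ 3) :
    UqG M 6 3 G ⊆ (R3 M G).filter (fun B : Finset α => M.eRk ((G \ B : Finset α) : Set α) = 3) := by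
  intro B hB
  obtain ⟨⟨-, hrB, h6⟩, hBG⟩ := mem_UqG_six_three.1 hB
  rw [Finset.mem_filter]
  refine ⟨UqG_subset_R3 G hB, ?_⟩
  apply le_antisymm
  · rw [← (mem_planes.1 hG).2.2]
    exact M.eRk_mono (Finset.coe_subset.2 Finset.sdiff_subset)
  · -- `E ∖ B ⊆ (E ∖ G) ∪ (G ∖ B)`
    have hsub : gr M \ B ⊆ (gr M \ G) ∪ (G \ B) := by
      intro y hy
      rw [Finset.mem_sdiff] at hy
      rw [Finset.mem_union, Finset.mem_sdiff, Finset.mem_sdiff]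
      by_cases hyG : y ∈ G
      · exact Or.inr ⟨hyG, hy.2⟩
      · exact Or.inl ⟨hy.1, hyG⟩
    have h := M.eRk_union_le_eRk_add_eRk ((gr M \ G : Finset α) : Set α) ((G \ B : Finset α) : Set α)
    rw [← Finset.coe_union] at h
    have h' := (M.eRk_mono (Finset.coe_subset.2 hsub)).trans h
    rw [h6] at h'
    have h'' : (6 : ℕ∞) ≤ 3 + M.eRk ((G \ B : Finset α) : Set α) :=
      h'.trans (add_le_add hr (le_refl _))
    obtain ⟨k, hk, -⟩ := eRk_eq_nat M (G \ B)
    rw [hk] at h'' ⊢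
    have : ((6 : ℕ) : ℕ∞) ≤ ((3 + k : ℕ) : ℕ∞) := by push_cast; exact h''
    have := (Nat.cast_le (α := ℕ∞)).1 this
    exact_mod_cast (show 3 ≤ k by omega)

/-- The supply of `G` is at least the sum over `B ∈ R₃(G)` of the supplies of the witness families. -/
theorem sum_R3_le_supply (G : Finset α) :
    ∑ B ∈ R3 M G, ∑ S ∈ (Yq M 6 3).filter (fun S => S ∩ G = B), fRule M G S / D M S ≤
      ∑ S ∈ Yq M 6 3, fRule M G S / D M S := by
  classical
  have hmaps : ∀ S ∈ Yq M 6 3, S ∩ G ∈ G.powerset := by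
    intro S _
    rw [Finset.mem_powerset]
    exact Finset.inter_subset_right
  rw [← Finset.sum_fiberwise_of_maps_to hmaps]
  apply Finset.sum_le_sum_of_subset_of_nonneg
  · intro B hB
    unfold R3 at hB
    exact (Finset.mem_filter.1 hB).1
  · intro B _ _
    apply Finset.sum_nonneg
    intro S _
    exact div_nonneg (fRule_nonneg M G S) (D_nonneg M S)

/-- The three planar inequalities of a plane `G` (the types `t = 1, 2, 3`), each stated for its rank of `E ∖ G`. -/
def PlanarIneqs (M : Matroid α) [M.Finite] (G : Finset α) : Prop :=
  (M.eRk ((gr M \ G : Finset α) : Set α) = 5 →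
    3 * (((R3 M G).card : ℚ) - 1) ≤ ∑ B ∈ R3 M G, vSupply M B 5) ∧
  (M.eRk ((gr M \ G : Finset α) : Set α) = 4 →
    3 * (((R3 M G).card : ℚ) - 1 -
      ((G.filter (fun a => M.eRk ((G.erase a : Finset α) : Set α) = 3)).card : ℚ)) ≤
      ∑ B ∈ R3 M G, vSupply M B 4) ∧
  (M.eRk ((gr M \ G : Finset α) : Set α) = 3 →
    3 * ((((R3 M G).filter (fun B : Finset α => M.eRk ((G \ B : Finset α) : Set α) = 3)).card : ℚ)) ≤
      ∑ B ∈ R3 M G, vSupply M B 3)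

/-- **The per-plane inequality for a plane of type `t ≥ 1` from its planar inequalities.**  `M` simple of rank `≥ 6`,
`G` a plane with `ρ(E ∖ G) ≤ 5`: if `G` satisfies `PlanarIneqs`, then `3·#U_G ≤ Σ_{S ∈ Y(6,3)} f(G, S) / Σ_{G'} f(G', S)`. -/
theorem perPlane_small_of_planar (hs : Simple M) {G : Finset α} (hG : G ∈ planes M)
    (hrE : (6 : ℕ∞) ≤ M.eRank) (hr5 : M.eRk ((gr M \ G : Finset α) : Set α) ≤ 5) (hI : PlanarIneqs M G) :
    (3 : ℚ) * ((UqG M 6 3 G).card : ℚ) ≤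
      ∑ S ∈ Yq M 6 3, fRule M G S / ∑ G' ∈ planes M, fRule M G' S := by
  classical
  set W := gr M \ G with hWdef
  have hWg : W ⊆ gr M := Finset.sdiff_subset
  have hWG : Disjoint W G := Finset.sdiff_disjoint
  have hGg : G ⊆ gr M := (mem_planes.1 hG).1
  -- `G ∪ W = E`, of rank `≥ 6`
  have hGW : G ∪ W = gr M := by
    rw [hWdef, Finset.union_sdiff_of_subset hGg]
  have hrGW : (6 : ℕ∞) ≤ M.eRk ((G ∪ W : Finset α) : Set α) := by
    rw [hGW, coe_gr, M.eRk_ground]; exact hrE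
  -- `ρ(W) ≥ 3` (submodularity), hence `|W| ≥ 3`
  have hrW3 : (3 : ℕ∞) ≤ M.eRk (W : Set α) := by
    have h := M.eRk_union_le_eRk_add_eRk (G : Set α) (W : Set α)
    rw [← Finset.coe_union, (mem_planes.1 hG).2.2] at h
    have h' := hrGW.trans h
    obtain ⟨k, hk, -⟩ := eRk_eq_nat M W
    rw [hk] at h' ⊢
    have : ((6 : ℕ) : ℕ∞) ≤ ((3 + k : ℕ) : ℕ∞) := by push_cast; exact h'
    have := (Nat.cast_le (α := ℕ∞)).1 this
    exact_mod_cast (show 3 ≤ k by omega)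
  obtain ⟨r, hr, hrle⟩ := eRk_eq_nat M W
  have hr3 : 3 ≤ r := by rw [hr] at hrW3; exact_mod_cast hrW3
  have hr5 : r ≤ 5 := by rw [hr] at hr5; exact_mod_cast hr5
  have hn3 : 3 ≤ W.card := hr3.trans hrle
  have hY : ∀ S, S ⊆ gr M → (3 : ℕ∞) < M.eRk (S : Set α) → M.eRk (S : Set α) < 6 → S ∈ Yq M 6 3 :=
    fun S h1 h2 h3 => mem_Yq_six_three.2 ⟨h1, h2, h3⟩
  -- the supply from `R₃(G)`, with `r` outside points
  have hsupply : ∑ B ∈ R3 M G, vSupply M B r ≤ ∑ S ∈ Yq M 6 3, fRule M G S / D M S := by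
    calc ∑ B ∈ R3 M G, vSupply M B r ≤ ∑ B ∈ R3 M G, vSupply M B W.card := by
          apply Finset.sum_le_sum
          intro B _
          exact vSupply_mono M B hr3 hrle
      _ ≤ ∑ B ∈ R3 M G, ∑ S ∈ (Yq M 6 3).filter (fun S => S ∩ G = B), fRule M G S / D M S := by
          apply Finset.sum_le_sum
          intro B hB
          unfold R3 at hB
          rw [Finset.mem_filter, Finset.mem_powerset] at hB
          exact supply_ge_vSupply hs hG hB.1 hB.2 hWg hWG hn3 hrGW (Yq M 6 3) hY
      _ ≤ ∑ S ∈ Yq M 6 3, fRule M G S / D M S := sum_R3_le_supply G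
  have hgoal : ∑ S ∈ Yq M 6 3, fRule M G S / ∑ G' ∈ planes M, fRule M G' S =
      ∑ S ∈ Yq M 6 3, fRule M G S / D M S := rfl
  rw [hgoal]
  obtain ⟨hI1, hI2, hI3⟩ := hI
  -- the three types
  rcases (show r = 5 ∨ r = 4 ∨ r = 3 by omega) with h5 | h4 | h3
  · subst h5
    have hd := card_UqG_add_one_le hG (by rw [hr]; exact_mod_cast le_refl _)
    have hd' : ((UqG M 6 3 G).card : ℚ) ≤ ((R3 M G).card : ℚ) - 1 := by
      have : (((UqG M 6 3 G).card + 1 : ℕ) : ℚ) ≤ ((R3 M G).card : ℚ) := by exact_mod_cast hd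
      rw [Nat.cast_add, Nat.cast_one] at this
      linarith
    have := hI1 (by rw [hr]; exact_mod_cast rfl)
    linarith
  · subst h4
    have hd := card_UqG_add_gprime_le hG (by rw [hr]; exact_mod_cast le_refl _)
    have hd' : ((UqG M 6 3 G).card : ℚ) ≤ ((R3 M G).card : ℚ) - 1 -
        ((G.filter (fun a => M.eRk ((G.erase a : Finset α) : Set α) = 3)).card : ℚ) := by
      have : (((UqG M 6 3 G).card + 1 +
          (G.filter (fun a => M.eRk ((G.erase a : Finset α) : Set α) = 3)).card : ℕ) : ℚ) ≤
          ((R3 M G).card : ℚ) := by exact_mod_cast hd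
      rw [Nat.cast_add, Nat.cast_add, Nat.cast_one] at this
      linarith
    have := hI2 (by rw [hr]; exact_mod_cast rfl)
    linarith
  · subst h3
    have hd := Finset.card_le_card (UqG_subset_demand3 hG (by rw [hr]; exact_mod_cast le_refl _))
    have hd' : ((UqG M 6 3 G).card : ℚ) ≤
        (((R3 M G).filter (fun B : Finset α => M.eRk ((G \ B : Finset α) : Set α) = 3)).card : ℚ) := by
      exact_mod_cast hd
    have := hI3 (by rw [hr]; exact_mod_cast rfl)
    linarith

end SixThree

end PercRepro
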